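import Mathlib

/-!
# Route `TropicalKugaSatakeCayley`, support S5 `CayleyHodgeRankTwo` (stmt-HodgeConjecture-18573) — part B1:
# values of an alternating form on words of basis vectors

Generic bookkeeping for the certified cusp computation (part B): for a continuous alternating form `c`
on a real normed space `V` with a basis `b` indexed by a linear order,

* `tkc_apply_update_basis` — the slot-`m` term of the derivation `D_N c` at a basis word, expanded in
  the basis: `c(b_v with slot m replaced by N b_{v m}) = Σ_q ⟨N b_{v m}, q⟩ · c(b ∘ v[m ↦ q])`;
* `tkc_apply_basis_of_not_injective` — `c(b ∘ u) = 0` for a word with a repeated letter;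
* `tkc_apply_basis_eq_sign_sort` — for an injective word `u`, `c(b ∘ u) = sign(sort u) · c(b ∘ ū)` with
  `ū = u ∘ Tuple.sort u` the increasing rearrangement (`AlternatingMap.map_perm`), and `ū` is strictly
  increasing (`tkc_strictMono_comp_sort`).

* `tkc_deriv_eq_zero_of_table_srt` — the same test with an arbitrary (cheap) sorting function in place of
  `Tuple.sort`, its correctness being part of the decidable hypothesis (appended, gen 42).

Together with `tkc_deriv_eq_zero_of_strictMono` (part B0) this turns the hypotheses of the flatness
criterion (part A3) for an explicit form into a finite sum over its table of values on increasing words.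
Theorems only: no definition, no named fact, no sorry.

## References

* [LangeBirkenhake1992] H. Lange, Ch. Birkenhake, Complex Abelian Varieties (1992), §1.1.3.
-/

noncomputable section

set_option linter.dupNamespace false

namespace Summit.HodgeConjecture.HodgeConjecture.Theorems

section BasisWords

variable {V : Type*} [NormedAddCommGroup V] [NormedSpace ℝ V] {k : ℕ} {ι : Type*}

/-- **The slot-`m` derivation term at a basis word, expanded in the basis**:
`c(…, N b_{v m}, …) = Σ_q (b.repr (N b_{v m}) q) · c(b ∘ v[m ↦ q])`. [folklore] -/
theorem tkc_apply_update_basis [Fintype ι] [DecidableEq ι] (b : Module.Basis ι ℝ V)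
    (c : V [⋀^Fin k]→L[ℝ] ℂ) (N : V →ₗ[ℝ] V) (v : Fin k → ι) (m : Fin k) :
    c (Function.update (fun i => b (v i)) m (N (b (v m)))) =
      ∑ q, (b.repr (N (b (v m))) q) • c (fun i => b (Function.update v m q i)) := by
  classical
  conv_lhs => rw [← b.sum_repr (N (b (v m)))]
  rw [show c (Function.update (fun i => b (v i)) m (∑ q, (b.repr (N (b (v m)))) q • b q)) =
      (c.toContinuousLinearMap (fun i => b (v i)) m) (∑ q, (b.repr (N (b (v m)))) q • b q) from rfl,
    map_sum]
  refine Finset.sum_congr rfl fun q _ => ?_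
  rw [map_smul]
  congr 1
  change c (Function.update (fun i => b (v i)) m (b q)) = _
  congr 1
  funext i
  by_cases hi : i = m
  · subst hi; simp
  · simp [Function.update_of_ne hi]

/-- A word with a repeated letter gives `0`. [folklore] -/
theorem tkc_apply_basis_of_not_injective (b : Module.Basis ι ℝ V) (c : V [⋀^Fin k]→L[ℝ] ℂ)
    {u : Fin k → ι} (hu : ¬ Function.Injective u) : c (fun i => b (u i)) = 0 :=
  c.map_eq_zero_of_not_injective _ fun h => hu (Function.Injective.of_comp (f := b) h)

/-- The increasing rearrangement of an injective word is strictly increasing. [folklore] -/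
theorem tkc_strictMono_comp_sort [LinearOrder ι] {u : Fin k → ι} (hu : Function.Injective u) :
    StrictMono (u ∘ Tuple.sort u) :=
  (Tuple.monotone_sort u).strictMono_of_injective (hu.comp (Tuple.sort u).injective)

/-- **Value on an injective word = sign of the sorting permutation × value on the increasing
rearrangement**: `c(b ∘ u) = sign(Tuple.sort u) · c(b ∘ (u ∘ Tuple.sort u))`. [folklore] -/
theorem tkc_apply_basis_eq_sign_sort [LinearOrder ι] (b : Module.Basis ι ℝ V) (c : V [⋀^Fin k]→L[ℝ] ℂ)
    (u : Fin k → ι) :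
    c (fun i => b (u i)) =
      ((Equiv.Perm.sign (Tuple.sort u) : ℤ) : ℂ) * c (fun i => b ((u ∘ Tuple.sort u) i)) := by
  classical
  have h1 : (fun i => b (u i)) = (fun i => b ((u ∘ Tuple.sort u) i)) ∘ (Tuple.sort u).symm := by
    funext i
    simp only [Function.comp_apply, Equiv.apply_symm_apply]
  rw [h1, ← ContinuousAlternatingMap.coe_toAlternatingMap, AlternatingMap.map_perm,
    ContinuousAlternatingMap.coe_toAlternatingMap, Equiv.Perm.sign_symm, Units.smul_def,
    ← Int.cast_smul_eq_zsmul ℂ, smul_eq_mul]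

/-- **The derivation test in table form.** For an alternating form `c`, a basis `b` over a linear order,
a linear operator `N` and a function `T` on words recording the values of `c` on INCREASING words
(`c(b ∘ w) = T w` for strictly increasing `w`): if for every strictly increasing word `v`
`Σ_m Σ_q ⟨N b_{v m}, q⟩ · ε(v[m↦q]) · T(sorted v[m↦q]) = 0`, where `ε` is the sign of the sorting
permutation (and the term is dropped when `v[m↦q]` repeats a letter), then `D_N c = 0` identically.
[folklore] -/
theorem tkc_deriv_eq_zero_of_table [Fintype ι] [DecidableEq ι] [LinearOrder ι] (b : Module.Basis ι ℝ V)
    (c : V [⋀^Fin k]→L[ℝ] ℂ) (N : V →ₗ[ℝ] V) (T : (Fin k → ι) → ℂ)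
    (hT : ∀ w : Fin k → ι, StrictMono w → c (fun i => b (w i)) = T w)
    (h : ∀ v : Fin k → ι, StrictMono v →
      ∑ m, ∑ q, (b.repr (N (b (v m))) q) •
        (if Function.Injective (Function.update v m q) then
          ((Equiv.Perm.sign (Tuple.sort (Function.update v m q)) : ℤ) : ℂ) *
            T (Function.update v m q ∘ Tuple.sort (Function.update v m q))
         else 0) = 0)
    (D : V [⋀^Fin k]→ₗ[ℝ] ℂ) (hD : ∀ u, D u = ∑ m, c (Function.update u m (N (u m)))) :
    D = 0 := by
  classical
  -- first on increasing words
  have hsorted : ∀ w : Fin k → ι, StrictMono w → D (fun i => b (w i)) = 0 := by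
    intro w hw
    rw [hD, ← h w hw]
    refine Finset.sum_congr rfl fun m _ => ?_
    rw [tkc_apply_update_basis b c N w m]
    refine Finset.sum_congr rfl fun q _ => ?_
    congr 1
    by_cases hinj : Function.Injective (Function.update w m q)
    · rw [if_pos hinj, tkc_apply_basis_eq_sign_sort b c (Function.update w m q),
        hT _ (tkc_strictMono_comp_sort hinj)]
    · rw [if_neg hinj, tkc_apply_basis_of_not_injective b c hinj]
  -- then on all words of distinct basis vectors, by sorting
  refine Module.Basis.ext_alternating b fun v hv => ?_
  rw [AlternatingMap.zero_apply]
  have h1 : (fun i => b (v i)) = (fun i => b ((v ∘ Tuple.sort v) i)) ∘ (Tuple.sort v).symm := by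
    funext i
    simp only [Function.comp_apply, Equiv.apply_symm_apply]
  rw [h1, AlternatingMap.map_perm, hsorted _ (tkc_strictMono_comp_sort hv), smul_zero]

end BasisWords

section BasisWordsSrt

variable {V : Type*} [NormedAddCommGroup V] [NormedSpace ℝ V] {k : ℕ} {ι : Type*}

/-- **Value on an injective word through ANY sorting permutation**: if `u ∘ σ` is the increasing
rearrangement of `u` then `c(b ∘ u) = sign σ · c(b ∘ (u ∘ σ))` (so a cheap, purpose-built sorting
permutation may replace `Tuple.sort` in kernel computations). [folklore] -/
theorem tkc_apply_basis_eq_sign_of_perm (b : Module.Basis ι ℝ V) (c : V [⋀^Fin k]→L[ℝ] ℂ)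
    (u : Fin k → ι) (σ : Equiv.Perm (Fin k)) :
    c (fun i => b (u i)) = ((Equiv.Perm.sign σ : ℤ) : ℂ) * c (fun i => b ((u ∘ σ) i)) := by
  classical
  have h1 : (fun i => b (u i)) = (fun i => b ((u ∘ σ) i)) ∘ σ.symm := by
    funext i
    simp only [Function.comp_apply, Equiv.apply_symm_apply]
  rw [h1, ← ContinuousAlternatingMap.coe_toAlternatingMap, AlternatingMap.map_perm,
    ContinuousAlternatingMap.coe_toAlternatingMap, Equiv.Perm.sign_symm, Units.smul_def,
    ← Int.cast_smul_eq_zsmul ℂ, smul_eq_mul]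

/-- **The derivation test in table form, with a custom sorting function.** As
`tkc_deriv_eq_zero_of_table`, but the increasing rearrangement of the words `v[m ↦ q]` is produced by an
arbitrary function `srt` (e.g. an explicit cycle), whose correctness `StrictMono (u ∘ srt u)` is part of
the (decidable) hypothesis, required only where the matrix entry is non-zero and the word injective.
[folklore] -/
theorem tkc_deriv_eq_zero_of_table_srt [Fintype ι] [DecidableEq ι] [LinearOrder ι]
    (b : Module.Basis ι ℝ V) (c : V [⋀^Fin k]→L[ℝ] ℂ) (N : V →ₗ[ℝ] V) (T : (Fin k → ι) → ℂ)
    (srt : (Fin k → ι) → Equiv.Perm (Fin k))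
    (hT : ∀ w : Fin k → ι, StrictMono w → c (fun i => b (w i)) = T w)
    (hsrt : ∀ v : Fin k → ι, StrictMono v → ∀ m q, b.repr (N (b (v m))) q ≠ 0 →
      Function.Injective (Function.update v m q) →
        StrictMono (Function.update v m q ∘ srt (Function.update v m q)))
    (h : ∀ v : Fin k → ι, StrictMono v →
      ∑ m, ∑ q, (b.repr (N (b (v m))) q) •
        (if Function.Injective (Function.update v m q) then
          ((Equiv.Perm.sign (srt (Function.update v m q)) : ℤ) : ℂ) *
            T (Function.update v m q ∘ srt (Function.update v m q))
         else 0) = 0)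
    (D : V [⋀^Fin k]→ₗ[ℝ] ℂ) (hD : ∀ u, D u = ∑ m, c (Function.update u m (N (u m)))) :
    D = 0 := by
  classical
  have hsorted : ∀ w : Fin k → ι, StrictMono w → D (fun i => b (w i)) = 0 := by
    intro w hw
    rw [hD, ← h w hw]
    refine Finset.sum_congr rfl fun m _ => ?_
    rw [tkc_apply_update_basis b c N w m]
    refine Finset.sum_congr rfl fun q _ => ?_
    by_cases hz : b.repr (N (b (w m))) q = 0
    · rw [hz, zero_smul, zero_smul]
    congr 1
    by_cases hinj : Function.Injective (Function.update w m q)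
    · rw [if_pos hinj, tkc_apply_basis_eq_sign_of_perm b c (Function.update w m q)
        (srt (Function.update w m q)), hT _ (hsrt w hw m q hz hinj)]
    · rw [if_neg hinj, tkc_apply_basis_of_not_injective b c hinj]
  refine Module.Basis.ext_alternating b fun v hv => ?_
  rw [AlternatingMap.zero_apply]
  have h1 : (fun i => b (v i)) = (fun i => b ((v ∘ Tuple.sort v) i)) ∘ (Tuple.sort v).symm := by
    funext i
    simp only [Function.comp_apply, Equiv.apply_symm_apply]
  rw [h1, AlternatingMap.map_perm, hsorted _ (tkc_strictMono_comp_sort hv), smul_zero]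

end BasisWordsSrt

end Summit.HodgeConjecture.HodgeConjecture.Theorems

end
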